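import Summits.KontsevichZagierPeriods.KontsevichZagierPeriods.Theses.UnfoldedStokes
import Literature.NumberTheory.Transcendental.KZCalculusProofs

/-!
# `StokesGeneration` (stmt-KontsevichZagierPeriods-3586) — rule (1b) redundancy: auxiliary lemmas

cdisprove (refuter) auxiliary file for `Negative/IntegrandAddRedundant.lean` (integrand additivity
is derivable from domain additivity and Newton–Leibniz in the calculus of `KZCalculus.lean`):
semialgebraic bands `σ × [a, b]` along the last coordinate, integrability of `(x, t) ↦ f x · w t` on
a band of height one for a bounded continuous weight `w`, the `C¹` smoothstep primitives
`3t² − 2t³`, `3(t−1)² − 2(t−1)³` and the gluing of their derivatives at `t = 1`.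

[Kontsevich–Zagier 2001, §1.2 rule (3)]
-/

noncomputable section

namespace Summit.KontsevichZagierPeriods.UnfoldedStokes.StokesGenerationNegative

open MeasureTheory Set MvPolynomial
open Literature.NumberTheory.Transcendental
open Literature.NumberTheory.Transcendental.KZ
open Literature.ModelTheory.ExponentialFields (IsSemialgebraic)

variable {n : ℕ}

/-! ## Bands `σ × [a, b]` along the last coordinate -/

/-- The band `{(x, t) | x ∈ σ, a ≤ t ≤ b}` over a `ℚ`-semialgebraic `σ ⊆ ℝⁿ` with natural-number
edges is `ℚ`-semialgebraic. [cite: KontsevichZagier2001, §1.2 rule (3)] -/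
theorem isSemialgebraic_band {σ : Set (Fin n → ℝ)} (hσ : IsSemialgebraic ℚ σ) (a b : ℕ) :
    IsSemialgebraic ℚ {z : Fin (n + 1) → ℝ | Fin.init z ∈ σ ∧ (a : ℝ) ≤ z (Fin.last n) ∧
      z (Fin.last n) ≤ (b : ℝ)} := by
  have h1 : IsSemialgebraic ℚ {z : Fin (n + 1) → ℝ | (a : ℝ) ≤ z (Fin.last n)} := by
    simpa using Literature.ModelTheory.ExponentialFields.isSemialgebraic_setOf_eval_le (k := ℚ)
      (R := ℝ) (a : MvPolynomial (Fin (n + 1)) ℚ) (X (Fin.last n))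
  have h2 : IsSemialgebraic ℚ {z : Fin (n + 1) → ℝ | z (Fin.last n) ≤ (b : ℝ)} := by
    simpa using Literature.ModelTheory.ExponentialFields.isSemialgebraic_setOf_eval_le (k := ℚ)
      (R := ℝ) (X (Fin.last n)) (b : MvPolynomial (Fin (n + 1)) ℚ)
  convert (hσ.setOf_init_mem.inter h1).inter h2 using 1
  ext z
  simp only [mem_setOf_eq, mem_inter_iff, and_assoc]

/-- `(x, t) ↦ f x` is absolutely integrable on the band `σ × [j, j+1]` for `f` integrable on `σ`
(`KZ.IntegralRep.integrableOn_slabDomain`, restated). [folklore] -/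
theorem integrableOn_init_band (r : IntegralRep n) (j : ℕ) :
    IntegrableOn (fun z : Fin (n + 1) → ℝ => r.integrand (Fin.init z))
      {z : Fin (n + 1) → ℝ | Fin.init z ∈ r.domain ∧ (j : ℝ) ≤ z (Fin.last n) ∧
        z (Fin.last n) ≤ (j : ℝ) + 1} :=
  r.integrableOn_slabDomain j

/-- A bounded continuous weight in the last coordinate keeps `(x, t) ↦ f x · w t` integrable on a
band of height one. [folklore] -/
theorem integrableOn_init_mul_band (r : IntegralRep n) (j : ℕ) (w : ℝ → ℝ) (hw : Continuous w)
    (C : ℝ) (hC : ∀ t, (j : ℝ) ≤ t → t ≤ (j : ℝ) + 1 → |w t| ≤ C) :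
    IntegrableOn (fun z : Fin (n + 1) → ℝ => r.integrand (Fin.init z) * w (z (Fin.last n)))
      {z : Fin (n + 1) → ℝ | Fin.init z ∈ r.domain ∧ (j : ℝ) ≤ z (Fin.last n) ∧
        z (Fin.last n) ≤ (j : ℝ) + 1} := by
  have hmeas : MeasurableSet {z : Fin (n + 1) → ℝ | Fin.init z ∈ r.domain ∧ (j : ℝ) ≤ z (Fin.last n) ∧
      z (Fin.last n) ≤ (j : ℝ) + 1} := by
    have := Literature.ModelTheory.ExponentialFields.IsSemialgebraic.measurableSet_holds
      (isSemialgebraic_band r.isSemialgebraic_domain j (j + 1))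
    simpa using this
  have hint := integrableOn_init_band r j
  have hwm : AEStronglyMeasurable (fun z : Fin (n + 1) → ℝ => w (z (Fin.last n)))
      (volume.restrict {z : Fin (n + 1) → ℝ | Fin.init z ∈ r.domain ∧ (j : ℝ) ≤ z (Fin.last n) ∧
        z (Fin.last n) ≤ (j : ℝ) + 1}) :=
    (hw.comp (continuous_apply (Fin.last n))).aestronglyMeasurable
  refine Integrable.mono (hint.norm.const_mul C).norm ?_ ?_
  · exact hint.aestronglyMeasurable.mul hwm
  · refine ae_restrict_of_forall_mem hmeas fun z hz => ?_
    have hb := hC _ hz.2.1 hz.2.2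
    have hCnn : 0 ≤ C := (abs_nonneg _).trans hb
    simp only [norm_mul, Real.norm_eq_abs, abs_abs]
    rw [abs_of_nonneg hCnn, mul_comm |r.integrand (Fin.init z)| |w (z (Fin.last n))|]
    exact mul_le_mul_of_nonneg_right hb (abs_nonneg _)

/-! ## The smoothstep primitives -/

/-- `d/dt [c(3t² − 2t³)] = c·6t(1−t)`. [folklore] -/
theorem hasDerivAt_smoothstep₁ (c t : ℝ) :
    HasDerivAt (fun s : ℝ => c * (3 * s ^ 2 - 2 * s ^ 3)) (c * (6 * t * (1 - t))) t := by
  have h2 : HasDerivAt (fun s : ℝ => s ^ 2) (2 * t) t := by simpa using hasDerivAt_pow 2 t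
  have h3 : HasDerivAt (fun s : ℝ => s ^ 3) (3 * t ^ 2) t := by simpa using hasDerivAt_pow 3 t
  exact (((h2.const_mul 3).sub (h3.const_mul 2)).const_mul c).congr_deriv (by ring)

/-- `d/dt [c₀ + c(3(t−1)² − 2(t−1)³)] = c·6(t−1)(2−t)`. [folklore] -/
theorem hasDerivAt_smoothstep₂ (c₀ c t : ℝ) :
    HasDerivAt (fun s : ℝ => c₀ + c * (3 * (s - 1) ^ 2 - 2 * (s - 1) ^ 3))
      (c * (6 * (t - 1) * (2 - t))) t := by
  have h := ((hasDerivAt_smoothstep₁ c (t - 1)).comp t ((hasDerivAt_id t).sub_const 1)).const_add c₀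
  exact h.congr_deriv (by ring)

/-- Gluing at `t = 1`: a function equal to `A` on `t ≤ 1` and to `B` on `t > 1`, with `A 1 = B 1`
and `A' 1 = B' 1 = d`, has derivative `d` at `1`. [folklore] -/
theorem hasDerivAt_glue_one {A B h : ℝ → ℝ} {d : ℝ} (hA : HasDerivAt A d 1) (hB : HasDerivAt B d 1)
    (hAB : A 1 = B 1) (hle : ∀ s, s ≤ 1 → h s = A s) (hgt : ∀ s, 1 < s → h s = B s) :
    HasDerivAt h d 1 := by
  have hl : HasDerivWithinAt h d (Iic 1) 1 :=
    hA.hasDerivWithinAt.congr (fun s hs => hle s hs) (hle 1 le_rfl)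
  have hr : HasDerivWithinAt h d (Ici 1) 1 := by
    refine hB.hasDerivWithinAt.congr (fun s hs => ?_) (by rw [hle 1 le_rfl, hAB])
    rcases eq_or_lt_of_le (mem_Ici.mp hs) with h1 | h1
    · rw [← h1, hle 1 le_rfl, hAB]
    · exact hgt s h1
  have := hl.union hr
  rwa [Iic_union_Ici, hasDerivWithinAt_univ] at this

end Summit.KontsevichZagierPeriods.UnfoldedStokes.StokesGenerationNegative
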